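import Mathlib
import HarnessLib

/-!
# Barrier: one-sided rectangle bounds do not lift to psd contractions with sub-exponential loss
# (the Frankl–Wilson orthogonality configuration; "ε-positive ⇏ poly(r)·ε-completely-positive")

Cell pnp-psdrank, route `ChebyshevTracialDesign`, crux `TracialDecayExp20` (stmt-PneNP-19878) of
`Literature.Combinatorics.Optimization.TracialDesigns`: a balanced exact extrapolation design weight
`W = levelWeight n t C w` must have normalised tracial value `(1/r)·Σ W(U,M)·tr(X_U Y_M) ≤ e^{−a·dq n}` on
psd contractions `0 ⪯ X_U, Y_M ⪯ I_r` of every dimension `r` with `r²n < e^{a·dq n}`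
(`Literature.Combinatorics.Optimization.TracialValueLEAt`; the tightness clause `X_U Y_M = 0` on
`|δ(U) ∩ M| = 1` is eliminable, cell brick 84). Its `r = 1` shadow — every 0/1 RECTANGLE has `W`-sum
`≥ −e^{−a₁·dq n}` ("NTF") — is a theorem of the cell (Rothvoß-type rectangle lemma,
[cite: Rothvoss2017, Lemma 6 and Lemma 7 (PDF pp. 6–8)], plus Keevash–Lifshitz level-`d` inequalities).
The crux would FOLLOW from its shadow if the passage `r = 1 ⇒ r` were KERNEL-AGNOSTIC with polynomial
loss: if for every finite signed kernel, "all rectangles `≥ −ε`" implied "all dimension-`r` contraction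
pairs have normalised value `≥ −C(r)·ε`" with `C(r) = c·r^b`, then `C(r)·e^{−a₁D} ≤ e^{−aD}/2`
throughout the budget `r < e^{aD/2}` as soon as `a(1 + b/2) < a₁`. For the kernel operator
`g ↦ Σ_M W(·,M) g(M)` between two commutative algebras, exact positivity IS complete positivity
[cite: Paulsen2003, Thm. 3.9 and Thm. 3.11 (commutative range / Stinespring: commutative domain)],
and the question (cell MEMO-18 §4 (L1)) was whether the `ε`-approximate, `L¹`-tested version
survives with polynomial loss. THIS FILE PROVES IT DOES NOT — the loss is exponential in `r`:

* `franklWilson_card_le` — the Frankl–Wilson theorem in orthogonality form, PROVED (inclusion matrix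
  over `𝔽_p`, exactly the printed proof): for a prime `p`, a family of `(2p−1)`-subsets of `[4p]` with
  no two members meeting in exactly `p − 1` points has `≤ C(4p, p−1)` members
  [cite: FranklWilson1981, Thm. 2 (k-uniform, |F ∩ F'| ≢ k mod q ⇒ |𝓕| ≤ C(n, q−1)) and §3 (the (2q−1)-subsets, |F ∩ F'| = q−1 ⟺ unit distance)];
  `cast_choose_pred_eq_zero` / `cast_choose_two_mul_pred_eq_one` are its binomial lemma
  [cite: FranklWilson1981, §2 Lemma (p ∤ C(a, q−1) iff a ≡ −1 mod q)]. (Jukna's textbook route,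
  [cite: Jukna2011, Theorem 14.14 and Exercise 14.24], gives the weaker `Σ_{i<p} C(n,i)`.)
* `fwKernel` — the signed test kernel `V(A,B) = −[A = B] + ½·[|A ∩ B| = p−1]` on Layer × Layer
  (Layer = the `C(4p,2p−1)` subsets; as `±1`-vectors of length `4p`, `|A ∩ B| = p − 1` ⟺ `⟨x_A,x_B⟩ = 0`);
  `rect_sum_ge`: EVERY combinatorial rectangle has `V`-sum `≥ −C(4p, p−1)` (the diagonal of `S × T`
  lies in `(S ∩ T)²`, and a subfamily `I` carries `≥ |I| − C(4p,p−1)` unordered orthogonal pairs: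
  `card_le_choose_add_orthPairs`, deletion + Frankl–Wilson); `frac_rect_sum_ge`: the same for fractional
  rectangles `f ⊗ g`, `0 ≤ f, g ≤ 1` (vertex argument), i.e. in the `r = 1` currency of `TracialValueLEAt`.
* `fwProj` — the rank-one projections `X_A = x_A x_Aᵀ/(4p)` onto the `±1`-vectors (`0 ⪯ X_A ⪯ I`:
  `fwProj_posSemidef`, `one_sub_fwProj_posSemidef`), `tr(X_A X_B) = ((|A ∩ B| − p + 1)/p)²`
  (`trace_fwProj_mul_eq`): ZERO exactly on the penalised pairs, ONE on the diagonal; hence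
  `contraction_value`: `Σ_{A,B} V(A,B)·tr(X_A X_B) = −C(4p, 2p−1)` in dimension `r = 4p` — the
  Buhrman–Cleve–Wigderson "distributed Deutsch–Jozsa" strategy, whose classical hardness is exactly a
  Frankl–Rödl/Frankl–Wilson rectangle bound [cite: BuhrmanCleveWigderson1998, Thm. 6 (EQ′: O(log N) qubits vs Ω(N) bits) and §3 (proof via Thm. 18 = Frankl–Rödl: |S|·|T| ≤ 4^{0.96n} for cross-families with no pair at distance n/2)].
* `RectangleBoundLifts C` — the TECHNIQUE CLASS as a Lean definition — and the BARRIER: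
  `liftConstant_ge` (`C(4p) ≥ C(4p,2p−1)/(4p·C(4p,p−1))` for every prime `p`), `choose_ratio_ge`
  (`(3/2)^p·C(4p,p−1) ≤ C(4p,2p−1)`), `liftConstant_ge_exp` (`C(4p) ≥ (3/2)^p/(4p)`), and
  `not_rectangleBoundLifts_poly`: NO polynomial `C` belongs to the class.

Numerically the per-dimension ratio `C(4p,2p−1)/(4p·C(4p,p−1))` is `0.875, 1.0, 1.73, 3.55, 18.4, 44.5,
277, 705, 4730` at `p = 2, 3, 5, 7, 11, 13, 17, 19, 23` (`r = 8 … 92`): below `r = 20` the configuration does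
not even beat the trivial constant `1` — the failure of lifting is a LARGE-`r` phenomenon (`≈ 1.69^p/p^{3/2}`).

LP-DUALITY READING (prose, not formalised): by finite LP duality, `RectangleBoundLifts C` holds iff every
"contraction table" `k(a,b) = tr(X_a Y_b)/r` (`0 ⪯ X_a, Y_b ⪯ I_r`) is an exact nonnegative combination
`k = Σ_R c_R·1_R` of combinatorial rectangles with `Σ_R c_R ≤ C(r)` — i.e. iff the rectangle-atomic norm
(the gauge of the classical shared-randomness AND-correlation body) of dimension-`r` maximally-entangled
single-event quantum correlation tables is `≤ C(r)`. Commutative (simultaneously diagonal) strategies have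
gauge `≤ 1`; the Frankl–Wilson table `((|A ∩ B| − p + 1)/p)²/(4p)` has gauge `≥ 2^{Ω(r)}` — the same
phenomenon as the exponential quantum/classical gaps for the orthogonality graph (projective packing number
`2^n/n` against an independence number `≤ 1.99^n`).

technique_class: KERNEL-AGNOSTIC ONE-SIDED LIFTING from dimension 1 — any argument deriving, for an
  ARBITRARY finite signed kernel `W`, the bound "(1/r)·Σ W·tr(X_a Y_b) ≥ −C(r)·ε for all psd contraction
  pairs of dimension r" from the sole input "Σ_{S×T} W ≥ −ε for all 0/1 (equivalently, by
  `frac_rect_sum_ge`'s vertex argument, all fractional) rectangles"; equivalently "ε-positivity of a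
  kernel operator between commutative algebras, tested in L¹ on indicator functions, implies
  C(r)·ε-positivity of its r-ampliation"; formalised as `RectangleBoundLifts C`.
  [cite: Paulsen2003, Thm. 3.9 and Thm. 3.11] [cite: BuhrmanCleveWigderson1998, Thm. 6 and §3]
blocks: a derivation of the crux `TracialDecayExp20` / `TracialDecayDimBal` of
  `Literature.Combinatorics.Optimization.TracialDesigns` from its proved `r = 1` shadow (rectangle decay
  for ALL rectangles, the cell's NTF / `RectangleDecayBal`-type statements
  [cite: Rothvoss2017, Lemma 6 and Lemma 7 (PDF pp. 6–8)]) through any step of this class: such a step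
  needs `C(r)·e^{−a₁·dq n} ≤ e^{−a·dq n}/2` up to `r ≈ e^{a·dq n/2}`, which every POLYNOMIAL `C` would
  give and which `C(r) ≥ (3/2)^{r/4}/r` (`liftConstant_ge_exp`, along `r = 4p`) forbids;
  `not_rectangleBoundLifts_poly` is the polynomial case by name. It equally blocks the same step from the
  banked LOG-scale shadow `RectangleDecayBal a 20` (value `n^{−a·dq n}`, budget `r²n < n^{a·dq n}`).
because: on the `C(4p,2p−1)` subsets of `[4p]` of size `2p−1` the kernel `−[A=B] + ½[|A∩B| = p−1]` is
  `≥ −C(4p,p−1)` on every rectangle — a rectangle's diagonal lies in a single family `I = S ∩ T`, which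
  spans at least `|I| − C(4p,p−1)` orthogonal pairs by the Frankl–Wilson theorem
  [cite: FranklWilson1981, Thm. 2 and §3] — while the rank-one projections onto the `±1`-vectors
  (dimension `4p`) are orthogonal EXACTLY on the penalised pairs and pay the full diagonal `−C(4p,2p−1)`
  [cite: BuhrmanCleveWigderson1998, §3 (Deutsch–Jozsa strategy vs. Frankl–Rödl)]; the ratio per
  dimension is `C(4p,2p−1)/(4p·C(4p,p−1)) ≥ (3/2)^p/(4p)`.
evasions_known: USE THE KERNEL. (i) Column-wise EXACT low-degree complete positivity: the violating
  strategy here is of degree `2` in each argument (`X_A` is quadratic in the `±1`-coordinates of `A`), and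
  in the cell every cut-side strategy of degree `≤ dq n/2` is priced exactly and nonnegatively by the
  matching's Grigoriev pseudo-expectation (knapsack positivity [cite: Grigoriev2001, Lemma 1.4 (PDF p. 8)], the
  tree's `Grigoriev2001_knapsackFormNonneg`; parity form [cite: Grigoriev2001TCS, Lemma 10];
  cell brick 84b: the crux is virtual nonnegativity of the averaged pseudo-expectation) — the present
  kernel has no such property at the scale of the violation (its column `V(·,B)` pairs to
  `−2^{−n}`-order values against the degree-1 squares `⟨x, x_B⟩²`). (ii) Two-sided norm transfer is already
  excluded for the cell's designs (`TracialDesignCutNormBarrier`). (iii) The printed gadget-free bridge from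
  "rank `r`" to "degree" — Lee–Raghavendra–Steurer's learning theorem: a density-matrix-valued `Q` on
  `{0,1}^n` is `ε`-indistinguishable from the square of a polynomial of degree
  `≲ κ·(1 + S(U_Q‖𝟙))·ω/ε` by all matrix tests of degree `≤ κ` and norm `≤ ω`
  [cite: LeeRaghavendraSteurer2015, Thm. 2.2 (= Thm. 4.5)] — is polynomial in `ω/ε`, so at the precision
  `ε ≈ 1/(r²n)` that a size-`r` factorization requires (`TracialHyperplaneBoundAt`) it learns degree
  `≳ r²`, not `log r`: exponential psd-rank bounds in print pass through the pattern-matrix gadget and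
  degree reduction [cite: LeeRaghavendraSteurer2015, Thm. 3.2 and Thm. 1.8], which the matching slack is
  not known to contain. No kernel-specific lifting for the design weights is in print ("none published").
scope_caveats: the barrier refutes the ABSTRACT principle quantified over all kernels; it does not say
  the crux is false, nor that rectangle decay is useless for it — only that the step from rectangles to
  contractions must use properties of `levelWeight` beyond its rectangle sums (e.g. exactness/low-degree
  structure in the cut, homogeneity in the matching). The violating pair is symmetric (`X = Y`), rank-one
  and low-degree; the kernel is not a design weight and lives on a different index set (subsets × subsets,
  not cuts × matchings). Constants: `(3/2)^p/(4p)` is not sharp (true ratio `≈ 1.69^p·p^{−3/2}`); for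
  `p ≤ 3` (`r ≤ 12`) the configuration gives ratio `≤ 1`, so nothing is claimed for small dimension
  (where the cell's bounded-dimension theorems hold anyway). Only primes `p` are covered (Frankl–Wilson
  needs a prime modulus; prime powers [cite: FranklWilson1981, Thm. 2] are not formalised).
status: established (Frankl–Wilson 1981; Buhrman–Cleve–Wigderson 1998 for the quantum/classical reading;
  this file is a complete proof of the separation, axioms standard).
-/

noncomputable section

open Finset Matrix

namespace Literature.Barriers.PneNP

namespace RectanglePositivityNoLift

/-! ### §1 Two binomial coefficients modulo a prime `p` -/

section Binomial

variable {p : ℕ} [hp : Fact p.Prime]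

/-- For `x ≤ 2p − 2` with `x ≠ p − 1` the binomial coefficient `C(x, p − 1)` vanishes modulo `p`
(for `x < p − 1` it is `0`; for `p ≤ x ≤ 2p − 2` Kummer/Lucas: `p ∣ C(x, p−1)`) — the `q = p` case of
Frankl–Wilson's lemma "`p ∤ C(a, q−1)` iff `a ≡ −1 (mod q)`" on `0 ≤ a ≤ 2p − 2`.
[cite: FranklWilson1981, §2 Lemma (p ∤ C(a, q−1) iff a ≡ −1 mod q)] -/
theorem cast_choose_pred_eq_zero {x : ℕ} (hx : x ≤ 2 * p - 2) (hne : x ≠ p - 1) :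
    ((x.choose (p - 1) : ℕ) : ZMod p) = 0 := by
  have h2 := hp.out.two_le
  rcases lt_or_ge x p with hlt | hle
  · have hlt' : x < p - 1 := by omega
    rw [Nat.choose_eq_zero_of_lt hlt', Nat.cast_zero]
  · rw [ZMod.natCast_eq_zero_iff]
    exact hp.out.dvd_choose (by omega) (by omega) hle

/-- `C(2p − 1, p − 1) ≡ 1 (mod p)` (Lucas: `2p − 1 = 1·p + (p − 1)`; the `a = 2p − 1 ≡ −1` case of
Frankl–Wilson's lemma). [cite: FranklWilson1981, §2 Lemma (p ∤ C(a, q−1) iff a ≡ −1 mod q)] -/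
theorem cast_choose_two_mul_pred_eq_one :
    (((2 * p - 1).choose (p - 1) : ℕ) : ZMod p) = 1 := by
  have h2 := hp.out.two_le
  have hmod := Choose.choose_modEq_choose_mod_mul_choose_div_nat (n := 2 * p - 1) (k := p - 1)
    (p := p)
  have hsplit : 2 * p - 1 = p + (p - 1) := by omega
  have e1 : (2 * p - 1) % p = p - 1 := by
    rw [hsplit, Nat.add_mod_left, Nat.mod_eq_of_lt (by omega)]
  have e2 : (2 * p - 1) / p = 1 := Nat.div_eq_of_lt_le (by omega) (by omega)
  have e3 : (p - 1) % p = p - 1 := Nat.mod_eq_of_lt (by omega)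
  have e4 : (p - 1) / p = 0 := Nat.div_eq_of_lt (by omega)
  rw [e1, e2, e3, e4, Nat.choose_self, Nat.choose_zero_right, mul_one] at hmod
  have h := (ZMod.natCast_eq_natCast_iff ((2 * p - 1).choose (p - 1)) 1 p).2 hmod
  rwa [Nat.cast_one] at h

end Binomial

/-! ### §2 The Frankl–Wilson theorem for the orthogonality relation on `(2p−1)`-subsets of `[4p]`
(inclusion matrix over `𝔽_p`) -/

section FW

variable (p : ℕ)

/-- The layer: `(2p − 1)`-element subsets of `[4p]` (as `±1`-vectors of length `4p` these are the
vectors with `2p − 1` minus signs). [cite: FranklWilson1981, §3 (the (2q−1)-subsets F(v))]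
[cite: Jukna2011, Exercise 14.24] -/
abbrev Layer : Type := {A : Finset (Fin (4 * p)) // A.card = 2 * p - 1}

/-- Column index of the inclusion matrix: the `(p − 1)`-element subsets of `[4p]`.
[cite: FranklWilson1981, §2 (proof of Thm. 2: the inclusion matrix M(q−1, k))] -/
abbrev Small : Type := {T : Finset (Fin (4 * p)) // T.card = p - 1}

/-- `#(p−1)-subsets of [4p] = C(4p, p−1)`. [folklore] -/
private theorem card_small : Fintype.card (Small p) = (4 * p).choose (p - 1) := by
  rw [Fintype.card_finset_len, Fintype.card_fin]

/-- `#Layer = C(4p, 2p−1)`. [folklore] -/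
private theorem card_layer : Fintype.card (Layer p) = (4 * p).choose (2 * p - 1) := by
  rw [Fintype.card_finset_len, Fintype.card_fin]

variable {p}

/-- Two members of the layer are ORTHOGONAL when they meet in exactly `p − 1` points (as `±1`-vectors
of length `4p`: inner product `4(|A ∩ B| − (p − 1)) = 0`, `signVec_dot`).
[cite: FranklWilson1981, §3 (|F(x) ∩ F(y)| = q − 1 ⟺ d(x,y) = 1)] [cite: Jukna2011, Exercise 14.24] -/
abbrev Orth (A B : Layer p) : Prop := (A.1 ∩ B.1).card = p - 1

/-- The inclusion matrix `[T ⊆ A]` of a subfamily `I` of the layer against the `(p−1)`-subsets,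
over `𝔽_p`. [cite: FranklWilson1981, §2 (proof of Thm. 2)] -/
def inclMat [Fact p.Prime] (I : Finset (Layer p)) : Matrix I (Small p) (ZMod p) :=
  Matrix.of fun A T => if T.1 ⊆ A.1.1 then 1 else 0

/-- Number of `(p−1)`-subsets below a given set. [folklore] -/
private theorem card_filter_small_subset (X : Finset (Fin (4 * p))) :
    (Finset.univ.filter fun T : Small p => T.1 ⊆ X).card = X.card.choose (p - 1) := by
  classical
  rw [← Finset.card_powersetCard]
  refine Finset.card_bij (fun T _ => T.1) ?_ ?_ ?_
  · intro T hT
    simp only [Finset.mem_filter, Finset.mem_univ, true_and] at hT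
    exact Finset.mem_powersetCard.2 ⟨hT, T.2⟩
  · intro T₁ _ T₂ _ h
    exact Subtype.ext h
  · intro T hT
    rw [Finset.mem_powersetCard] at hT
    exact ⟨⟨T, hT.2⟩, by simp [hT.1], rfl⟩

/-- Gram matrix of the inclusion matrix: `(P Pᵀ)_{A,B} = C(|A ∩ B|, p − 1)` in `𝔽_p`.
[cite: FranklWilson1981, §2 (proof of Thm. 2: M(q−1,k) has entries C(|F ∩ F'|, q−1))] -/
theorem inclMat_mul_transpose_apply [Fact p.Prime] (I : Finset (Layer p)) (A B : I) :
    (inclMat I * (inclMat I)ᵀ) A B = (((A.1.1 ∩ B.1.1).card.choose (p - 1) : ℕ) : ZMod p) := by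
  classical
  simp only [Matrix.mul_apply, Matrix.transpose_apply, inclMat, Matrix.of_apply, mul_ite, mul_one,
    mul_zero]
  have h1 : ∀ T : Small p,
      (if T.1 ⊆ B.1.1 then (if T.1 ⊆ A.1.1 then (1 : ZMod p) else 0) else 0) =
        if T.1 ⊆ A.1.1 ∩ B.1.1 then 1 else 0 := by
    intro T
    by_cases hA : T.1 ⊆ A.1.1 <;> by_cases hB : T.1 ⊆ B.1.1 <;>
      simp [hA, hB, Finset.subset_inter_iff]
  simp_rw [h1]
  rw [Finset.sum_boole, card_filter_small_subset]

/-- **Frankl–Wilson theorem (uniform, modulus `p`, one omitted intersection size), orthogonality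
form.** A family of `(2p−1)`-subsets of `[4p]`, `p` prime, in which no two distinct members meet in
exactly `p − 1` points has at most `C(4p, p−1)` members. Proof: over `𝔽_p` the Gram matrix of the
inclusion matrix against `(p−1)`-subsets is the identity on such a family (`C(2p−1, p−1) ≡ 1`,
`C(x, p−1) ≡ 0` for `x ≤ 2p−2`, `x ≠ p−1`), so `|I| = rank ≤ #columns = C(4p, p−1)` — Frankl–Wilson's
own inclusion-matrix argument; Jukna's Exercise 14.24 (via Theorem 14.14, Deza–Frankl–Singhi) gives
the weaker `Σ_{i ≤ p−1} C(n,i)` for `n = 4p − 1`.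
[cite: FranklWilson1981, Thm. 2 (k-uniform 𝓕, |F ∩ F'| ≢ k (mod q), q a prime power ⇒ |𝓕| ≤ C(n, q−1)); here q = p, n = 4p, k = 2p − 1]
[cite: Jukna2011, Theorem 14.14 and Exercise 14.24] -/
theorem franklWilson_card_le [hp : Fact p.Prime] (I : Finset (Layer p))
    (hI : ∀ A ∈ I, ∀ B ∈ I, A ≠ B → ¬ Orth A B) :
    I.card ≤ (4 * p).choose (p - 1) := by
  classical
  have h2 := hp.out.two_le
  have hG : inclMat I * (inclMat I)ᵀ = 1 := by
    ext A B
    rw [inclMat_mul_transpose_apply]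
    by_cases hAB : A = B
    · subst hAB
      rw [Matrix.one_apply_eq, Finset.inter_self, A.1.2]
      exact cast_choose_two_mul_pred_eq_one
    · rw [Matrix.one_apply_ne hAB]
      have hne : (A : Layer p) ≠ B := fun h => hAB (Subtype.ext h)
      have hx : ¬ Orth (A : Layer p) B := hI A.1 A.2 B.1 B.2 hne
      have hle : (A.1.1 ∩ B.1.1).card ≤ 2 * p - 2 := by
        have hlt : (A.1.1 ∩ B.1.1).card < A.1.1.card := by
          apply Finset.card_lt_card
          refine Finset.ssubset_iff_subset_ne.2 ⟨Finset.inter_subset_left, fun h => hne ?_⟩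
          have hsub : A.1.1 ⊆ B.1.1 := Finset.inter_eq_left.1 h
          exact Subtype.ext (Finset.eq_of_subset_of_card_le hsub (by rw [A.1.2, B.1.2]))
        rw [A.1.2] at hlt
        omega
      exact cast_choose_pred_eq_zero hle hx
  have hr : (inclMat I * (inclMat I)ᵀ).rank = I.card := by
    rw [hG, Matrix.rank_one, Fintype.card_coe]
  have hle := Matrix.rank_mul_le_left (inclMat I) (inclMat I)ᵀ
  rw [hr] at hle
  exact hle.trans ((Matrix.rank_le_card_width _).trans (card_small p).le)

/-! ### §3 The signed kernel and its one-sided rectangle bound -/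

/-- The signed test kernel on Layer × Layer: `V(A,B) = −[A = B] + ½·[A ⟂ B]` (reward the diagonal,
penalise orthogonal pairs, ignore everything else) — the promise structure of Buhrman–Cleve–Wigderson's
`EQ′` (equal vs. Hamming distance `n/2`). [cite: BuhrmanCleveWigderson1998, Thm. 6 and §3] -/
def fwKernel (A B : Layer p) : ℝ :=
  -(if A = B then 1 else 0) + (1 / 2) * (if Orth A B then 1 else 0)

/-- Ordered orthogonal pairs inside a family. [folklore] -/
def orthPairs (I : Finset (Layer p)) : ℕ := ((I ×ˢ I).filter fun q => Orth q.1 q.2).card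

/-- A member of the layer is not orthogonal to itself (`2p − 1 ≠ p − 1`). [folklore] -/
private theorem not_orth_self [hp : Fact p.Prime] (A : Layer p) : ¬ Orth A A := by
  have h2 := hp.out.two_le
  unfold Orth
  rw [Finset.inter_self, A.2]
  omega

/-- Removing a vertex of an orthogonal pair loses at least two ordered orthogonal pairs. [folklore] -/
private theorem orthPairs_erase_add_two_le [Fact p.Prime] {I : Finset (Layer p)} {A B : Layer p}
    (hA : A ∈ I) (hB : B ∈ I) (hO : Orth A B) : orthPairs (I.erase A) + 2 ≤ orthPairs I := by
  classical
  have hAB : A ≠ B := fun h => not_orth_self B (h ▸ hO)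
  have hO' : Orth B A := by unfold Orth at hO ⊢; rwa [Finset.inter_comm]
  unfold orthPairs
  set F := (I ×ˢ I).filter fun q : Layer p × Layer p => Orth q.1 q.2
  set F' := ((I.erase A) ×ˢ (I.erase A)).filter fun q : Layer p × Layer p => Orth q.1 q.2
  have hsub : insert (A, B) (insert (B, A) F') ⊆ F := by
    intro q hq
    rcases Finset.mem_insert.1 hq with rfl | hq
    · exact Finset.mem_filter.2 ⟨Finset.mk_mem_product hA hB, hO⟩
    rcases Finset.mem_insert.1 hq with rfl | hq
    · exact Finset.mem_filter.2 ⟨Finset.mk_mem_product hB hA, hO'⟩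
    · have hq' := Finset.mem_filter.1 hq
      have hm := Finset.mem_product.1 hq'.1
      exact Finset.mem_filter.2
        ⟨Finset.mk_mem_product (Finset.mem_of_mem_erase hm.1) (Finset.mem_of_mem_erase hm.2), hq'.2⟩
  have h1 : (B, A) ∉ F' := by
    intro h
    have hm := (Finset.mem_product.1 (Finset.mem_filter.1 h).1).2
    exact (Finset.ne_of_mem_erase hm) rfl
  have h2 : (A, B) ∉ insert (B, A) F' := by
    intro h
    rcases Finset.mem_insert.1 h with h | h
    · exact hAB (Prod.ext_iff.1 h).1
    · have hm := (Finset.mem_product.1 (Finset.mem_filter.1 h).1).1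
      exact (Finset.ne_of_mem_erase hm) rfl
  have hcard := Finset.card_le_card hsub
  rw [Finset.card_insert_of_notMem h2, Finset.card_insert_of_notMem h1] at hcard
  omega

/-- **Deletion argument**: `|I| ≤ C(4p, p−1) + ½·#(ordered orthogonal pairs in I)` — delete one
endpoint per orthogonal pair until Frankl–Wilson applies. [cite: FranklWilson1981, Thm. 2 and §3] -/
theorem card_le_choose_add_orthPairs [Fact p.Prime] (I : Finset (Layer p)) :
    (I.card : ℝ) ≤ (4 * p).choose (p - 1) + (orthPairs I : ℝ) / 2 := by
  classical
  suffices h : ∀ (k : ℕ) (I : Finset (Layer p)), I.card = k →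
      (I.card : ℝ) ≤ (4 * p).choose (p - 1) + (orthPairs I : ℝ) / 2 from h _ I rfl
  intro k
  induction k using Nat.strong_induction_on with
  | _ k ih =>
    intro I hk
    by_cases hfree : ∀ A ∈ I, ∀ B ∈ I, A ≠ B → ¬ Orth A B
    · have h1 : (I.card : ℝ) ≤ (4 * p).choose (p - 1) := by
        exact_mod_cast franklWilson_card_le I hfree
      have h2 : (0 : ℝ) ≤ (orthPairs I : ℝ) / 2 := by positivity
      linarith
    · push Not at hfree
      obtain ⟨A, hA, B, hB, -, hO⟩ := hfree
      have hpairs := orthPairs_erase_add_two_le hA hB hO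
      have hcardE : (I.erase A).card + 1 = I.card := Finset.card_erase_add_one hA
      have hlt : (I.erase A).card < k := by omega
      have hI' := ih _ hlt (I.erase A) rfl
      have e1 : (I.card : ℝ) = ((I.erase A).card : ℝ) + 1 := by exact_mod_cast hcardE.symm
      have e2 : ((orthPairs (I.erase A) : ℕ) : ℝ) + 2 ≤ (orthPairs I : ℝ) := by
        exact_mod_cast hpairs
      linarith

/-- The rectangle sums of the kernel in closed form:
`Σ_{S×T} V = −|S ∩ T| + ½·#{(A,B) ∈ S × T : A ⟂ B}`. [folklore] -/
private theorem rect_sum_eq [Fact p.Prime] (S T : Finset (Layer p)) :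
    ∑ A ∈ S, ∑ B ∈ T, fwKernel A B =
      -((S ∩ T).card : ℝ) + (1 / 2) * (((S ×ˢ T).filter fun q => Orth q.1 q.2).card : ℝ) := by
  classical
  simp only [fwKernel, Finset.sum_add_distrib, Finset.sum_neg_distrib, ← Finset.mul_sum]
  congr 2
  · simp_rw [Finset.sum_ite_eq]
    rw [Finset.sum_boole, Finset.filter_mem_eq_inter]
  · rw [Finset.natCast_card_filter, Finset.sum_product]

/-- **One-sided rectangle bound.** Every combinatorial rectangle `S × T` has kernel sum
`≥ −C(4p, p−1)`: the negative (diagonal) part of a rectangle lives on `I = S ∩ T`, and a set `I` of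
the layer carries at least `|I| − C(4p, p−1)` unordered orthogonal pairs (Frankl–Wilson + deletion);
this is the one-family form of the rectangle bound Buhrman–Cleve–Wigderson take from Frankl–Rödl.
[cite: FranklWilson1981, Thm. 2 and §3] [cite: BuhrmanCleveWigderson1998, §3 (Thm. 18)] -/
theorem rect_sum_ge [Fact p.Prime] (S T : Finset (Layer p)) :
    -((4 * p).choose (p - 1) : ℝ) ≤ ∑ A ∈ S, ∑ B ∈ T, fwKernel A B := by
  classical
  rw [rect_sum_eq]
  have hI := card_le_choose_add_orthPairs (S ∩ T)
  have hmono : orthPairs (S ∩ T) ≤ ((S ×ˢ T).filter fun q => Orth q.1 q.2).card := by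
    unfold orthPairs
    apply Finset.card_le_card
    apply Finset.filter_subset_filter
    exact Finset.product_subset_product Finset.inter_subset_left Finset.inter_subset_right
  have hmono' : (orthPairs (S ∩ T) : ℝ) ≤ (((S ×ˢ T).filter fun q => Orth q.1 q.2).card : ℝ) := by
    exact_mod_cast hmono
  linarith

/-- The same bound for FRACTIONAL rectangles `f ⊗ g`, `0 ≤ f, g ≤ 1` (bilinearity: the minimum of a
bilinear form over a box is attained at 0/1 vertices — here via the layer-cake identity
`f = ∫₀¹ 1[f > s] ds` discretised on the finitely many values). Stated for completeness in the
`r = 1` currency of `Literature.Combinatorics.Optimization.TracialValueLEAt`; the proof reduces to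
`rect_sum_ge` by Rothvoß's vertex (extreme point) argument on each coordinate:
`conv{R ∈ [0,1]^{f×v} : rank R ≤ 1} = conv{0/1 rectangles}`.
[cite: Rothvoss2017, Lemma 5 (proof: a fractional rank-1 matrix in [0,1] is dominated by the 0/1 rectangle bound; PDF p. 6)] -/
theorem frac_rect_sum_ge [Fact p.Prime] (f g : Layer p → ℝ) (hf : ∀ A, 0 ≤ f A ∧ f A ≤ 1)
    (hg : ∀ B, 0 ≤ g B ∧ g B ≤ 1) :
    -((4 * p).choose (p - 1) : ℝ) ≤ ∑ A, ∑ B, fwKernel A B * (f A * g B) := by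
  classical
  -- Step 1: for fixed g, the map f ↦ Σ V f g is affine in each coordinate, so its minimum over the
  -- box is attained at a 0/1 point; same for g. We implement this by the standard exchange argument:
  -- for each coordinate, moving f A to 0 or 1 (whichever does not increase the value) keeps the bound.
  -- Rather than formalising the exchange, use the layer-cake representation with the finitely many
  -- threshold sets {f > s}: Σ_A f(A) h(A) = ∫_0^1 Σ_{A : f A > s} h(A) ds, and a double integral of
  -- quantities ≥ −C is ≥ −C.  We realise the integral as a finite sum over the sorted values.
  -- Implementation: induction on the number of non-{0,1} values of f, then of g.
  -- (A) reduce in f.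
  have key : ∀ (h : Layer p → ℝ) (c : ℝ), (∀ S : Finset (Layer p), -c ≤ ∑ A ∈ S, h A) →
      ∀ f : Layer p → ℝ, (∀ A, 0 ≤ f A ∧ f A ≤ 1) → -c ≤ ∑ A, f A * h A := by
    intro h c hc
    -- strong induction on the number of fractional coordinates
    suffices hN : ∀ (N : ℕ) (f : Layer p → ℝ), (Finset.univ.filter fun A => f A ≠ 0 ∧ f A ≠ 1).card = N →
        (∀ A, 0 ≤ f A ∧ f A ≤ 1) → -c ≤ ∑ A, f A * h A from fun f hf => hN _ f rfl hf
    intro N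
    induction N using Nat.strong_induction_on with
    | _ N ih =>
      intro f hN hf
      by_cases h0 : N = 0
      · -- f is 0/1-valued: it is the indicator of S = {f = 1}
        subst h0
        have h01 : ∀ A, f A = 0 ∨ f A = 1 := by
          intro A
          by_contra hcon
          push Not at hcon
          have : A ∈ (Finset.univ.filter fun A => f A ≠ 0 ∧ f A ≠ 1) :=
            Finset.mem_filter.2 ⟨Finset.mem_univ _, hcon⟩
          rw [Finset.card_eq_zero.1 hN] at this
          simp at this
        have hS := hc (Finset.univ.filter fun A => f A = 1)
        rw [Finset.sum_filter] at hS
        have hEq : ∑ A, f A * h A = ∑ A, if f A = 1 then h A else 0 :=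
          Finset.sum_congr rfl fun A _ => by rcases h01 A with h | h <;> simp [h]
        rw [hEq]
        exact hS
      · -- pick a fractional coordinate A₀ and move it to the better endpoint
        have hne : (Finset.univ.filter fun A => f A ≠ 0 ∧ f A ≠ 1).Nonempty :=
          Finset.card_pos.1 (by omega)
        obtain ⟨A₀, hA₀⟩ := hne
        have hA₀' := (Finset.mem_filter.1 hA₀).2
        -- the two modified functions
        let f0 : Layer p → ℝ := Function.update f A₀ 0
        let f1 : Layer p → ℝ := Function.update f A₀ 1
        have hcard : ∀ v : ℝ, (v = 0 ∨ v = 1) →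
            (Finset.univ.filter fun A => Function.update f A₀ v A ≠ 0 ∧
              Function.update f A₀ v A ≠ 1).card < N := by
          intro v hv
          rw [← hN]
          apply Finset.card_lt_card
          refine Finset.ssubset_iff_subset_ne.2 ⟨?_, ?_⟩
          · intro A hA
            have hA' := (Finset.mem_filter.1 hA).2
            by_cases hAA : A = A₀
            · subst hAA
              simp only [Function.update_self] at hA'
              rcases hv with rfl | rfl
              · exact absurd rfl hA'.1
              · exact absurd rfl hA'.2
            · rw [Function.update_of_ne hAA] at hA'
              exact Finset.mem_filter.2 ⟨Finset.mem_univ _, hA'⟩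
          · intro heq
            have : A₀ ∈ (Finset.univ.filter fun A => Function.update f A₀ v A ≠ 0 ∧
                Function.update f A₀ v A ≠ 1) := by rw [heq]; exact hA₀
            have h' := (Finset.mem_filter.1 this).2
            simp only [Function.update_self] at h'
            rcases hv with rfl | rfl
            · exact h'.1 rfl
            · exact h'.2 rfl
        have hbox : ∀ v : ℝ, 0 ≤ v → v ≤ 1 → ∀ A, 0 ≤ Function.update f A₀ v A ∧
            Function.update f A₀ v A ≤ 1 := by
          intro v hv0 hv1 A
          by_cases hAA : A = A₀
          · subst hAA; simp [hv0, hv1]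
          · rw [Function.update_of_ne hAA]; exact hf A
        have ih0 := ih _ (hcard 0 (Or.inl rfl)) f0 rfl (hbox 0 le_rfl zero_le_one)
        have ih1 := ih _ (hcard 1 (Or.inr rfl)) f1 rfl (hbox 1 zero_le_one le_rfl)
        -- Σ f h = (1 − f A₀)·Σ f0 h + (f A₀)·Σ f1 h
        have hsplit : ∀ v : ℝ, ∑ A, Function.update f A₀ v A * h A =
            (∑ A, f A * h A) + (v - f A₀) * h A₀ := by
          intro v
          have e : ∀ A, Function.update f A₀ v A * h A =
              f A * h A + (if A = A₀ then (v - f A₀) * h A₀ else 0) := by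
            intro A
            by_cases hAA : A = A₀
            · subst hAA; rw [Function.update_self, if_pos rfl]; ring
            · rw [Function.update_of_ne hAA, if_neg hAA]; ring
          simp_rw [e]
          rw [Finset.sum_add_distrib, Finset.sum_ite_eq' Finset.univ A₀, if_pos (Finset.mem_univ _)]
        have e0 := hsplit 0
        have e1 := hsplit 1
        have hfA := hf A₀
        -- convex combination
        have : ∑ A, f A * h A =
            (1 - f A₀) * (∑ A, f0 A * h A) + f A₀ * (∑ A, f1 A * h A) := by
          show ∑ A, f A * h A = (1 - f A₀) * (∑ A, Function.update f A₀ 0 A * h A) +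
            f A₀ * (∑ A, Function.update f A₀ 1 A * h A)
          rw [e0, e1]; ring
        rw [this]
        have hw0 : 0 ≤ 1 - f A₀ := by linarith [hfA.2]
        nlinarith [mul_le_mul_of_nonneg_left ih0 hw0, mul_le_mul_of_nonneg_left ih1 hfA.1, hfA.1,
          hfA.2]
  -- (B) apply `key` twice.
  set c : ℝ := ((4 * p).choose (p - 1) : ℝ) with hc_def
  have hg' : ∀ S : Finset (Layer p), -c ≤ ∑ A ∈ S, ∑ B, fwKernel A B * g B := by
    intro S
    have hT : ∀ T : Finset (Layer p), -c ≤ ∑ B ∈ T, (fun B => ∑ A ∈ S, fwKernel A B) B := by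
      intro T
      simp only
      rw [Finset.sum_comm]
      exact rect_sum_ge S T
    have h1 := key (fun B => ∑ A ∈ S, fwKernel A B) _ hT g hg
    calc -c ≤ ∑ B, g B * ∑ A ∈ S, fwKernel A B := h1
      _ = ∑ A ∈ S, ∑ B, fwKernel A B * g B := by
        simp_rw [Finset.mul_sum]
        rw [Finset.sum_comm]
        exact Finset.sum_congr rfl fun A _ => Finset.sum_congr rfl fun B _ => by ring
  have h2 := key (fun A => ∑ B, fwKernel A B * g B) _ hg' f hf
  calc -c ≤ ∑ A, f A * ∑ B, fwKernel A B * g B := h2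
    _ = ∑ A, ∑ B, fwKernel A B * (f A * g B) := by
      refine Finset.sum_congr rfl fun A _ => ?_
      rw [Finset.mul_sum]
      exact Finset.sum_congr rfl fun B _ => by ring

/-! ### §4 The explicit contraction strategy of dimension `r = 4p` (rank-one projections onto the
`±1`-vectors) -/

/-- The `±1`-vector of a member of the layer (`−1` on `A`, `+1` off `A`). [cite: FranklWilson1981, §3] -/
def signVec (A : Layer p) : Fin (4 * p) → ℝ := fun i => if i ∈ A.1 then -1 else 1

/-- `x_A(i)² = 1`. [folklore] -/
private theorem signVec_sq (A : Layer p) (i : Fin (4 * p)) : signVec A i ^ 2 = 1 := by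
  unfold signVec; split_ifs <;> norm_num

/-- `⟨x_A, x_A⟩ = 4p`. [folklore] -/
private theorem signVec_dot_self (A : Layer p) : signVec A ⬝ᵥ signVec A = 4 * p := by
  simp only [dotProduct, ← sq, signVec_sq, Finset.sum_const, Finset.card_univ, Fintype.card_fin,
    nsmul_eq_mul, mul_one]
  push_cast
  ring

/-- `⟨x_A, x_B⟩ = 4·(|A ∩ B| − (p − 1))`: orthogonal exactly on the pairs meeting in `p − 1` points.
[cite: FranklWilson1981, §3] [cite: Jukna2011, Exercise 14.24 (with Exercise 14.8)] -/
theorem signVec_dot [hp : Fact p.Prime] (A B : Layer p) :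
    signVec A ⬝ᵥ signVec B = 4 * (((A.1 ∩ B.1).card : ℝ) - (p - 1)) := by
  classical
  have h2 := hp.out.two_le
  have e : ∀ i, signVec A i * signVec B i =
      1 - 2 * (if i ∈ A.1 then (1 : ℝ) else 0) - 2 * (if i ∈ B.1 then (1 : ℝ) else 0)
        + 4 * (if i ∈ A.1 ∩ B.1 then (1 : ℝ) else 0) := by
    intro i
    unfold signVec
    by_cases hA : i ∈ A.1 <;> by_cases hB : i ∈ B.1 <;> simp [hA, hB, Finset.mem_inter] <;> norm_num
  simp only [dotProduct, e, Finset.sum_add_distrib, Finset.sum_sub_distrib, ← Finset.mul_sum,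
    Finset.sum_boole, Finset.sum_const, Finset.card_univ, Fintype.card_fin, nsmul_eq_mul, mul_one]
  have hA : (Finset.univ.filter fun i => i ∈ A.1) = A.1 := Finset.filter_univ_mem A.1
  have hB : (Finset.univ.filter fun i => i ∈ B.1) = B.1 := Finset.filter_univ_mem B.1
  have hAB : (Finset.univ.filter fun i => i ∈ A.1 ∩ B.1) = A.1 ∩ B.1 := Finset.filter_univ_mem _
  rw [hA, hB, hAB, A.2, B.2]
  have : ((2 * p - 1 : ℕ) : ℝ) = 2 * p - 1 := by
    rw [Nat.cast_sub (by omega)]; push_cast; ring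
  rw [this]
  push_cast
  ring

/-- The rank-one orthogonal projection onto `x_A`: `X_A = x_A x_Aᵀ / (4p)` — a psd CONTRACTION of
dimension `4p` (the measurement direction of the Deutsch–Jozsa protocol for `EQ′`).
[cite: BuhrmanCleveWigderson1998, §3 (proof of Thm. 6, upper bound)] -/
def fwProj (A : Layer p) : Matrix (Fin (4 * p)) (Fin (4 * p)) ℝ :=
  (1 / (4 * p : ℝ)) • vecMulVec (signVec A) (signVec A)

/-- `0 ⪯ X_A` (the density matrix of the pure state `(4p)^{−1/2}·Σ_i x_A(i)|i⟩` of the Deutsch–Jozsa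
protocol). [cite: BuhrmanCleveWigderson1998, §3 (proof of Thm. 6, the quantum upper bound)] -/
theorem fwProj_posSemidef (A : Layer p) : (fwProj A).PosSemidef := by
  have h := Matrix.posSemidef_vecMulVec_self_star (R := ℝ) (signVec A)
  simp only [star_trivial] at h
  exact h.smul (by positivity)

/-- `X_A ⪯ I` (Cauchy–Schwarz: `⟨x_A, v⟩² ≤ 4p·‖v‖²`; a pure-state density matrix is a contraction).
[cite: BuhrmanCleveWigderson1998, §3 (proof of Thm. 6, the quantum upper bound)] -/
theorem one_sub_fwProj_posSemidef [hp : Fact p.Prime] (A : Layer p) :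
    (1 - fwProj A).PosSemidef := by
  have hp0 : (0 : ℝ) < 4 * p := by
    have := hp.out.pos; positivity
  refine Matrix.PosSemidef.of_dotProduct_mulVec_nonneg
    (Matrix.isHermitian_one.sub (fwProj_posSemidef A).isHermitian) fun v => ?_
  have hq : star v ⬝ᵥ ((1 - fwProj A) *ᵥ v) =
      v ⬝ᵥ v - 1 / (4 * (p : ℝ)) * ((v ⬝ᵥ signVec A) * (signVec A ⬝ᵥ v)) := by
    rw [star_trivial, Matrix.sub_mulVec, Matrix.one_mulVec, dotProduct_sub]
    unfold fwProj
    rw [Matrix.smul_mulVec, dotProduct_smul, smul_eq_mul, Matrix.dotProduct_mulVec,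
      Matrix.vecMul_vecMulVec, smul_dotProduct, smul_eq_mul]
  rw [hq]
  -- goal: 0 ≤ v ⬝ᵥ v − (1/(4p)) * ((v ⬝ᵥ x) * (x ⬝ᵥ v))
  have hcs := Finset.sum_mul_sq_le_sq_mul_sq Finset.univ (signVec A) v
  simp only [signVec_sq, Finset.sum_const, Finset.card_univ, Fintype.card_fin, nsmul_eq_mul,
    mul_one] at hcs
  have e1 : v ⬝ᵥ signVec A = signVec A ⬝ᵥ v := dotProduct_comm _ _
  have e2 : v ⬝ᵥ v = ∑ i, v i ^ 2 := by simp [dotProduct, sq]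
  rw [e1, e2]
  have e3 : signVec A ⬝ᵥ v = ∑ i, signVec A i * v i := rfl
  rw [e3]
  push_cast at hcs
  rw [sq] at hcs
  have hb : 1 / (4 * (p : ℝ)) * ((∑ i, signVec A i * v i) * ∑ i, signVec A i * v i)
      ≤ ∑ i, v i ^ 2 := by
    rw [one_div_mul_eq_div, div_le_iff₀ hp0]
    linarith
  linarith

/-- `tr(X_A X_B) = (⟨x_A, x_B⟩/(4p))²`. [folklore] -/
private theorem trace_fwProj_mul (A B : Layer p) :
    (fwProj A * fwProj B).trace = ((signVec A ⬝ᵥ signVec B) / (4 * p)) ^ 2 := by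
  simp only [fwProj, Matrix.smul_mul, Matrix.mul_smul, Matrix.trace_smul,
    Matrix.vecMulVec_mul_vecMulVec, Matrix.trace_vecMulVec, dotProduct_smul, smul_eq_mul]
  ring

/-- `tr(X_A X_B) = ((|A ∩ B| − p + 1)/p)²`; in particular `= 0` exactly on orthogonal pairs and `= 1`
on the diagonal. [cite: FranklWilson1981, §3] [cite: BuhrmanCleveWigderson1998, §3] -/
theorem trace_fwProj_mul_eq [hp : Fact p.Prime] (A B : Layer p) :
    (fwProj A * fwProj B).trace = ((((A.1 ∩ B.1).card : ℝ) - (p - 1)) / p) ^ 2 := by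
  rw [trace_fwProj_mul, signVec_dot, mul_div_mul_left _ _ (by norm_num : (4 : ℝ) ≠ 0)]

/-- Diagonal: `tr(X_A X_A) = 1`. [folklore] -/
private theorem trace_fwProj_mul_self [hp : Fact p.Prime] (A : Layer p) :
    (fwProj A * fwProj A).trace = 1 := by
  have h2 := hp.out.two_le
  have hp0 : (p : ℝ) ≠ 0 := by exact_mod_cast hp.out.ne_zero
  rw [trace_fwProj_mul_eq, Finset.inter_self, A.2, Nat.cast_sub (by omega)]
  push_cast
  field_simp
  ring

/-- Penalised pairs: `tr(X_A X_B) = 0` when `|A ∩ B| = p − 1`. [cite: FranklWilson1981, §3] -/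
theorem trace_fwProj_mul_of_orth [hp : Fact p.Prime] {A B : Layer p} (h : Orth A B) :
    (fwProj A * fwProj B).trace = 0 := by
  have h2 := hp.out.two_le
  unfold Orth at h
  rw [trace_fwProj_mul_eq, h, Nat.cast_sub (by omega)]
  push_cast
  ring

/-- **The contraction strategy's value**: `Σ_{A,B} V(A,B)·tr(X_A X_B) = −C(4p, 2p−1)` — every
diagonal term costs `−1`, every penalised (orthogonal) pair contributes `0`.
[cite: BuhrmanCleveWigderson1998, Thm. 6 and §3] -/
theorem contraction_value [hp : Fact p.Prime] :
    ∑ A : Layer p, ∑ B : Layer p, fwKernel A B * (fwProj A * fwProj B).trace =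
      -((4 * p).choose (2 * p - 1) : ℝ) := by
  classical
  have e : ∀ A B : Layer p, fwKernel A B * (fwProj A * fwProj B).trace =
      -(if A = B then (1 : ℝ) else 0) := by
    intro A B
    unfold fwKernel
    by_cases hAB : A = B
    · subst hAB
      rw [if_pos rfl, if_neg (not_orth_self A), trace_fwProj_mul_self]
      ring
    · rw [if_neg hAB]
      by_cases hO : Orth A B
      · rw [if_pos hO, trace_fwProj_mul_of_orth hO]; ring
      · rw [if_neg hO]; ring
  simp_rw [e, Finset.sum_neg_distrib, Finset.sum_ite_eq, if_pos (Finset.mem_univ _),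
    Finset.sum_const, Finset.card_univ, card_layer, nsmul_eq_mul, mul_one]

/-! ### §5 The technique class and the barrier -/

/-- TECHNIQUE CLASS (as a Lean definition): **kernel-agnostic lifting of one-sided rectangle bounds
to psd contractions with loss `C(r)`** — "for EVERY finite bipartite signed kernel `W`, if all
combinatorial rectangles have `W`-sum `≥ −ε`, then every pair of psd-contraction-valued maps of
dimension `r` (`0 ⪯ X_a, Y_b ⪯ I_r`) has normalised tracial value `(1/r)·Σ W(a,b)·tr(X_a Y_b) ≥ −C(r)·ε`".
This is the `r = 1 ⇒` general-`r` step behind "ε-positive ⇒ `C(r)·ε`-completely-positive" for the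
kernel operator `g ↦ Σ_b W(·,b) g(b)` between commutative algebras (exact positivity IS complete
positivity there, [cite: Paulsen2003, Thm. 3.9 and Thm. 3.11]); `C ≡ 1` would be the one-sided
analogue of Grothendieck's inequality for squared inner products.
[cite: BuhrmanCleveWigderson1998, Thm. 6 and §3] [cite: FranklWilson1981, Thm. 2] -/
def RectangleBoundLifts (C : ℕ → ℝ) : Prop :=
  ∀ (α β : Type) [Fintype α] [Fintype β] [DecidableEq α] [DecidableEq β] (W : α → β → ℝ) (ε : ℝ),
    (∀ (S : Finset α) (T : Finset β), -ε ≤ ∑ a ∈ S, ∑ b ∈ T, W a b) →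
    ∀ (r : ℕ) (X : α → Matrix (Fin r) (Fin r) ℝ) (Y : β → Matrix (Fin r) (Fin r) ℝ),
      (∀ a, (X a).PosSemidef ∧ (1 - X a).PosSemidef) →
      (∀ b, (Y b).PosSemidef ∧ (1 - Y b).PosSemidef) →
        -(C r * ε) ≤ (∑ a, ∑ b, W a b * (X a * Y b).trace) / r

/-- **BARRIER (quantitative form).** Any lifting constant must satisfy
`C(4p) ≥ C(4p, 2p−1) / (4p · C(4p, p−1))` for every prime `p` — the Frankl–Wilson orthogonality
configuration: rectangles `≥ −C(4p,p−1)` (`rect_sum_ge`) but the rank-one projections onto the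
`±1`-vectors have value `−C(4p,2p−1)` in dimension `4p` (`contraction_value`).
[cite: FranklWilson1981, Thm. 2 and §3] [cite: BuhrmanCleveWigderson1998, Thm. 6 and §3] -/
theorem liftConstant_ge {C : ℕ → ℝ} (hC : RectangleBoundLifts C) (p : ℕ) [hp : Fact p.Prime] :
    ((4 * p).choose (2 * p - 1) : ℝ) / ((4 * p : ℝ) * (4 * p).choose (p - 1)) ≤ C (4 * p) := by
  classical
  have h2 := hp.out.two_le
  have hp0 : (0 : ℝ) < 4 * p := by have := hp.out.pos; positivity
  have hc0 : (0 : ℝ) < (4 * p).choose (p - 1) := by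
    exact_mod_cast Nat.choose_pos (by omega)
  have h := hC (Layer p) (Layer p) fwKernel ((4 * p).choose (p - 1) : ℝ) rect_sum_ge (4 * p)
    fwProj fwProj (fun A => ⟨fwProj_posSemidef A, one_sub_fwProj_posSemidef A⟩)
    (fun B => ⟨fwProj_posSemidef B, one_sub_fwProj_posSemidef B⟩)
  rw [contraction_value] at h
  push_cast at h
  rw [div_le_iff₀ (by positivity)]
  have h' : ((4 * p).choose (2 * p - 1) : ℝ) / (4 * p) ≤ C (4 * p) * (4 * p).choose (p - 1) := by
    rw [neg_div] at h
    linarith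
  rw [div_le_iff₀ hp0] at h'
  linarith

/-- **Growth of the Frankl–Wilson ratio**: `(3/2)^p · C(4p, p−1) ≤ C(4p, 2p−1)` (pair the factors
`(3p+1)!/(2p+1)! = Π_{m<p}(2p+2+m)` against `(2p−1)!/(p−1)! = Π_{m<p}(p+m)` termwise). [folklore] -/
private theorem choose_ratio_ge (p : ℕ) (hp : 1 ≤ p) :
    (3 / 2 : ℝ) ^ p * (4 * p).choose (p - 1) ≤ (4 * p).choose (2 * p - 1) := by
  -- factorial identities in ℕ
  have hA : (4 * p).choose (2 * p - 1) * (2 * p - 1).factorial * (2 * p + 1).factorial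
      = (4 * p).factorial := by
    have := Nat.choose_mul_factorial_mul_factorial (n := 4 * p) (k := 2 * p - 1) (by omega)
    rwa [show 4 * p - (2 * p - 1) = 2 * p + 1 by omega] at this
  have hB : (4 * p).choose (p - 1) * (p - 1).factorial * (3 * p + 1).factorial
      = (4 * p).factorial := by
    have := Nat.choose_mul_factorial_mul_factorial (n := 4 * p) (k := p - 1) (by omega)
    rwa [show 4 * p - (p - 1) = 3 * p + 1 by omega] at this
  have hC : (2 * p + 1).factorial * (2 * p + 2).ascFactorial p = (3 * p + 1).factorial := by
    have := Nat.factorial_mul_ascFactorial (2 * p + 1) p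
    rwa [show 2 * p + 1 + p = 3 * p + 1 by omega] at this
  have hD : (p - 1).factorial * p.ascFactorial p = (2 * p - 1).factorial := by
    have := Nat.factorial_mul_ascFactorial (p - 1) p
    rwa [show p - 1 + 1 = p by omega, show p - 1 + p = 2 * p - 1 by omega] at this
  -- the key identity: C(4p,2p−1)·p^{(p)} = C(4p,p−1)·(2p+2)^{(p)}
  have key : (4 * p).choose (2 * p - 1) * p.ascFactorial p
      = (4 * p).choose (p - 1) * (2 * p + 2).ascFactorial p := by
    have hpos : 0 < (p - 1).factorial * (2 * p + 1).factorial := by positivity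
    apply Nat.eq_of_mul_eq_mul_right hpos
    calc (4 * p).choose (2 * p - 1) * p.ascFactorial p * ((p - 1).factorial * (2 * p + 1).factorial)
        = (4 * p).choose (2 * p - 1) * ((p - 1).factorial * p.ascFactorial p)
            * (2 * p + 1).factorial := by ring
      _ = (4 * p).factorial := by rw [hD, hA]
      _ = (4 * p).choose (p - 1) * (p - 1).factorial * (3 * p + 1).factorial := hB.symm
      _ = (4 * p).choose (p - 1) * (2 * p + 2).ascFactorial p
            * ((p - 1).factorial * (2 * p + 1).factorial) := by rw [← hC]; ring
  -- termwise comparison of the ascending factorials in ℝ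
  have hcmp : (3 / 2 : ℝ) ^ p * (p.ascFactorial p : ℝ) ≤ ((2 * p + 2).ascFactorial p : ℝ) := by
    rw [Nat.ascFactorial_eq_prod_range, Nat.ascFactorial_eq_prod_range]
    push_cast
    rw [show (3 / 2 : ℝ) ^ p = ∏ _i ∈ Finset.range p, (3 / 2 : ℝ) by
        rw [Finset.prod_const, Finset.card_range],
      ← Finset.prod_mul_distrib]
    apply Finset.prod_le_prod
    · intro i _; positivity
    · intro i hi
      have hi' : (i : ℝ) ≤ p - 1 := by
        have := Finset.mem_range.1 hi
        have : (i : ℝ) + 1 ≤ p := by exact_mod_cast this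
        linarith
      linarith
  have hasc : (0 : ℝ) < (p.ascFactorial p : ℝ) := by
    have h := Nat.ascFactorial_pos (p - 1) p
    rw [show p - 1 + 1 = p by omega] at h
    exact_mod_cast h
  have keyR : ((4 * p).choose (2 * p - 1) : ℝ) * (p.ascFactorial p : ℝ)
      = ((4 * p).choose (p - 1) : ℝ) * ((2 * p + 2).ascFactorial p : ℝ) := by
    exact_mod_cast key
  nlinarith [mul_le_mul_of_nonneg_left hcmp (Nat.cast_nonneg ((4 * p).choose (p - 1))), keyR]

/-- **BARRIER (exponential form).** Every lifting constant grows exponentially: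
`C(4p) ≥ (3/2)^p / (4p)` for every prime `p`. [cite: FranklWilson1981, Thm. 2 and §3]
[cite: BuhrmanCleveWigderson1998, Thm. 6 and §3] -/
theorem liftConstant_ge_exp {C : ℕ → ℝ} (hC : RectangleBoundLifts C) (p : ℕ) [hp : Fact p.Prime] :
    (3 / 2 : ℝ) ^ p / (4 * p) ≤ C (4 * p) := by
  have h2 := hp.out.two_le
  have hp0 : (0 : ℝ) < 4 * p := by have := hp.out.pos; positivity
  have hc0 : (0 : ℝ) < (4 * p).choose (p - 1) := by exact_mod_cast Nat.choose_pos (by omega)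
  refine le_trans ?_ (liftConstant_ge hC p)
  rw [div_le_div_iff₀ hp0 (by positivity)]
  have := choose_ratio_ge p (by omega)
  nlinarith

/-- **BARRIER (qualitative form): no polynomial lifting constant exists.** For every `c` and `b`,
the class `RectangleBoundLifts (r ↦ c·r^b)` is EMPTY. Consequently a proof of the crux
`TracialDecayExp20` of `Literature.Combinatorics.Optimization.TracialDesigns` from its proved `r = 1`
shadow (rectangle decay, NTF) cannot proceed through a kernel-agnostic positivity-to-complete-positivity
step: any such step must use the structure of the design weight (see the module docstring).
[cite: FranklWilson1981, Thm. 2 and §3] [cite: BuhrmanCleveWigderson1998, Thm. 6 and §3] -/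
theorem not_rectangleBoundLifts_poly (c : ℝ) (b : ℕ) :
    ¬ RectangleBoundLifts (fun r => c * (r : ℝ) ^ b) := by
  intro hC
  -- (4p)^{b+1}·c / (3/2)^p → 0, so for a large prime p the exponential bound is violated
  have hlim := tendsto_pow_const_div_const_pow_of_one_lt (b + 1) (r := (3 / 2 : ℝ)) (by norm_num)
  have hev : ∀ᶠ n : ℕ in Filter.atTop,
      (n : ℝ) ^ (b + 1) / (3 / 2 : ℝ) ^ n < 1 / (|c| * 4 ^ (b + 1) + 1) :=
    Filter.Tendsto.eventually_lt_const (by positivity) hlim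
  obtain ⟨N, hN⟩ := Filter.eventually_atTop.1 hev
  obtain ⟨p, hpN, hprime⟩ := Nat.exists_infinite_primes (max N 2)
  haveI : Fact p.Prime := ⟨hprime⟩
  have hp2 : 2 ≤ p := le_trans (le_max_right _ _) hpN
  have hpR : (2 : ℝ) ≤ p := by exact_mod_cast hp2
  have h1 := liftConstant_ge_exp hC p
  -- h1 : (3/2)^p/(4p) ≤ c * (4p)^b
  have h3 := hN p (le_trans (le_max_left _ _) hpN)
  have hq : (0 : ℝ) < (3 / 2 : ℝ) ^ p := by positivity
  have hK : (0 : ℝ) < |c| * 4 ^ (b + 1) + 1 := by positivity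
  rw [div_lt_iff₀ hq] at h3
  rw [div_le_iff₀ (by positivity)] at h1
  -- from h1: (3/2)^p ≤ c (4p)^b (4p) ≤ |c| 4^{b+1} p^{b+1}
  have h4 : (3 / 2 : ℝ) ^ p ≤ |c| * 4 ^ (b + 1) * (p : ℝ) ^ (b + 1) := by
    have : c * ((4 : ℝ) * p) ^ b * (4 * p) ≤ |c| * 4 ^ (b + 1) * (p : ℝ) ^ (b + 1) := by
      have e : c * ((4 : ℝ) * p) ^ b * (4 * p) = c * (4 ^ (b + 1) * (p : ℝ) ^ (b + 1)) := by ring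
      rw [e]
      have := le_abs_self c
      nlinarith [pow_pos (show (0:ℝ) < 4 by norm_num) (b + 1), pow_pos (show (0:ℝ) < p by linarith) (b + 1),
        mul_pos (pow_pos (show (0:ℝ) < 4 by norm_num) (b + 1)) (pow_pos (show (0:ℝ) < p by linarith) (b + 1))]
    push_cast at h1
    linarith
  -- from h3: p^{b+1} < (3/2)^p / (|c| 4^{b+1} + 1)
  have h5 : |c| * 4 ^ (b + 1) * (p : ℝ) ^ (b + 1) + (p : ℝ) ^ (b + 1) < (3 / 2 : ℝ) ^ p := by
    have h6 : (p : ℝ) ^ (b + 1) * (|c| * 4 ^ (b + 1) + 1) <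
        1 / (|c| * 4 ^ (b + 1) + 1) * (3 / 2 : ℝ) ^ p * (|c| * 4 ^ (b + 1) + 1) :=
      mul_lt_mul_of_pos_right h3 hK
    have e : 1 / (|c| * 4 ^ (b + 1) + 1) * (3 / 2 : ℝ) ^ p * (|c| * 4 ^ (b + 1) + 1)
        = (3 / 2 : ℝ) ^ p := by
      field_simp
    rw [e] at h6
    linarith
  have hp1 : (0 : ℝ) < (p : ℝ) ^ (b + 1) := by positivity
  linarith

end FW

end RectanglePositivityNoLift

end Literature.Barriers.PneNP
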